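import Summits.NavierStokesRegularity.FunctionalMining.NoGo.TopBotEigSplitCeiling
import HarnessLib

/-!
# FunctionalMining / NoGo — K10c: the splitting of the symmetrised top–bottom core for every
# real `q ≥ 2` — `∃ c > 0, TopBotEigSplitting q c` PROVED (door D-K6 (c), finite-dimensional side)

HONEST FRAMING. Search for candidate a priori estimates; no regularity claim. Nothing about
Navier–Stokes is proved or asserted in this file: finite-dimensional inequalities for flat
`3 × 3` tensors (and, in K10b, two lemmas of one-variable real analysis). Cell `pub-nsfunc`,
no-go seat (gen 38), kernel candidate K10 = three files K10a `NoGo/TopBotEigSplitFloor`,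
K10b `NoGo/TopBotEigSplitCeiling`, K10c `NoGo/TopBotEigSplitting` (this order of imports).

THE TARGET. The staged K9 `NoGo/TopBotEigHeatCoerciveSplit` reduced the door-(c) node
`TopBotEigHeatCoercivePos q` (real `q > 2`: heat coercivity of the symmetrised core `Φ_q + Ψ_q`)
to the finite-dimensional obligation `TopEig.TopBotEigSplitting q c` with a share `c > 0`:
`M ≥ 0` and a convex `1`-Lipschitz `h ≥ 0` on flat tensors with
`λ(A)^q + λ(−A)^q = M·h(A)^q + c·‖A‖^q` for every symmetric trace-free `A` (`λ = TopEig.lam`, the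
top Rayleigh value of the tree; `λ(S) = λ₁`, `λ(−S) = −λ₃` on a strain). K10 PROVES
`∃ c > 0, TopBotEigSplitting q c` for EVERY REAL `q ≥ 2` (K10c
`TopEig.topBotEigSplitting_exists`, the obligation written out word for word), by an elementary
SECOND-DIFFERENCE argument that uses no eigenvalue calculus beyond `λ`: no Lewis–Sendov / Davis
spectral-function theory, no smoothness of eigenvalues, no majorisation.

WHAT IS PROVED HERE [ours]:
* §7 the trace-free symmetric part `π = TopEig.tfProj` (entries `(Aᵢⱼ + Aⱼᵢ)/2 − δᵢⱼ tr(A)/3`):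
  additive, homogeneous, `= id` on symmetric trace-free tensors, values symmetric trace-free, and a
  contraction `‖πA‖ ≤ ‖A‖` (`‖A‖² − ‖πA‖² = Σ_{i<j}(Aᵢⱼ − Aⱼᵢ)²/2 + tr(A)²/3`).
* §8 **`TopEig.convexOn_splitDensity_tfProj (hq : 2 ≤ q) (hc0 : 0 ≤ c) (hc : c ≤ shareConst q) :
  ConvexOn ℝ univ (k_{q,c} ∘ π)`** — along every line the K10b small-step second differences and
  Lemma (M′) (`convexOn_univ_of_local_midpoint`); where the line meets `0` one uses `k ≥ 0 = k(0)`.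
* §9 the GAUGE `TopEig.splitGauge q c A = (k_{q,c}(πA)/2)^{1/q}`: `≥ 0`, `h(tA) = t·h(A)` (`t ≥ 0`),
  even, `h ≤ ‖·‖`, **convex** (`convexOn_splitGauge`: convexity + `q`-homogeneity of `k∘π`, an
  `ε`-rescaling into the unit gauge ball), subadditive, **`1`-Lipschitz** (`lipschitzWith_splitGauge`),
  and the SPLITTING IDENTITY `λ(A)^q + λ(−A)^q = 2·h(A)^q + c·‖A‖^q` on symmetric trace-free `A`;
  hence **`TopEig.topBotEigSplitting_shareConst (hq : 2 ≤ q)`** = `TopBotEigSplitting q (shareConst q)`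
  written out (`M = 2`, `h = splitGauge q (shareConst q)`) and
  **`TopEig.topBotEigSplitting_exists (hq : 2 ≤ q) : ∃ c, 0 < c ∧ (TopBotEigSplitting q c, written
  out)`**. With K9's `topBotEigHeatCoercivePos_of_splitting` this gives `TopBotEigHeatCoercivePos q`
  for every real `q > 2` (rate `shareConst q·q/(2·npConst q)`, not sharp) — the composition is the
  no-go seat's JOINT check file and is filed once K9 and this file are both in the tree.

WHAT IS NOT PROVED HERE. Door (c) AT `q = 2` is K7/K8 (rate window `[8π²/3, 8π²]`, share `1/3`
sharp); `3/2 < q < 2` (door (b)) is untouched; no sharp share or rate for `q > 2`.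

PROVENANCE / STATUS. Typed and farm-checked by the no-go seat (gen 38): K10a stand-alone, K10b and
K10c as concatenations with their imports (evidence `pub-nsfunc-nogo/sieveld/ktg/`, incl. the
K9∘K10 JOINT check `TopBotEigHeatCoercivePos q` for every real `q > 2` and the value
`shareConst 4 = 1/999`); STATUS: STAGED (`pub-nsfunc-nogo/NoGo/<name>.STAGING.lean`), filing by a
prove seat on the lead's word, in the order K10a → K10b → K10c, after K7/K8/K9 (the planner seat
cannot file under `FunctionalMining/`). Search for candidate a priori estimates; no regularity
claim. [ours; K1-Q6 (c) = door D-K6 (c), finite-dimensional side, `q ≥ 2`]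
FILING (prove seat g26, REQUEST #24c): declarations byte-identical to the no-go seat's staged `TopBotEigSplitting.STAGING.lean` adfeb426ab00243f; this FILING line plus 10 one-line docstrings added for the gate's lint.docstring (tfProj_apply, isSymTF_tfProj, tfProj_of_isSymTF/_add/_smul/_neg/_sub, splitDensity_tfProj_nonneg, splitGauge_nonneg/_neg); declarations themselves byte-identical; these are the only changes.
-/

noncomputable section

open Finset Set Real

namespace Summit.NavierStokesRegularity.FunctionalMining

namespace TopEig

/-! ## 7. The trace-free symmetric part `π` (a linear contraction onto the symmetric trace-free
tensors) -/

/-- `π(A)ᵢⱼ = (Aᵢⱼ + Aⱼᵢ)/2 − δᵢⱼ·tr(A)/3`. [ours; bookkeeping] -/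
def tfProj (A : Tens3) : Tens3 :=
  WithLp.toLp 2 fun ij : Fin 3 × Fin 3 =>
    (A ij + A (ij.2, ij.1)) / 2 - if ij.1 = ij.2 then (∑ i, A (i, i)) / 3 else 0

/-- Entries of the trace-free symmetric part `π(A)`. [bookkeeping] -/
@[simp] theorem tfProj_apply (A : Tens3) (i j : Fin 3) :
    tfProj A (i, j) = (A (i, j) + A (j, i)) / 2 - if i = j then (∑ i, A (i, i)) / 3 else 0 := rfl

/-- `π(A)` is symmetric trace-free. [bookkeeping] -/
theorem isSymTF_tfProj (A : Tens3) : IsSymTF (tfProj A) := by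
  refine ⟨fun i j => ?_, ?_⟩
  · simp only [tfProj_apply]
    by_cases hij : i = j
    · subst hij; simp
    · simp [hij, Ne.symm hij, add_comm]
  · simp only [tfProj_apply, if_true, Fin.sum_univ_three]
    ring

/-- `π(A) = A` for symmetric trace-free `A`. [bookkeeping] -/
theorem tfProj_of_isSymTF {A : Tens3} (hA : IsSymTF A) : tfProj A = A := by
  ext ⟨i, j⟩
  simp only [tfProj_apply, hA.tr, zero_div, ite_self, sub_zero, ← hA.symm i j]
  ring

/-- `π` is additive. [bookkeeping] -/
theorem tfProj_add (A B : Tens3) : tfProj (A + B) = tfProj A + tfProj B := by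
  ext ⟨i, j⟩
  simp only [tfProj_apply, WithLp.ofLp_add, Pi.add_apply, sum_add_distrib]
  split_ifs <;> ring

/-- `π` commutes with scalars. [bookkeeping] -/
theorem tfProj_smul (t : ℝ) (A : Tens3) : tfProj (t • A) = t • tfProj A := by
  ext ⟨i, j⟩
  simp only [tfProj_apply, WithLp.ofLp_smul, Pi.smul_apply, smul_eq_mul, ← mul_sum]
  split_ifs <;> ring

/-- `π(−A) = −π(A)`. [bookkeeping] -/
theorem tfProj_neg (A : Tens3) : tfProj (-A) = -tfProj A := by
  rw [← neg_one_smul ℝ A, tfProj_smul, neg_one_smul]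

/-- `π(A − B) = π(A) − π(B)`. [bookkeeping] -/
theorem tfProj_sub (A B : Tens3) : tfProj (A - B) = tfProj A - tfProj B := by
  rw [sub_eq_add_neg, tfProj_add, tfProj_neg, ← sub_eq_add_neg]

/-- `π` is a contraction: `‖π(A)‖ ≤ ‖A‖` (`‖A‖² − ‖πA‖² = Σ_{i<j}(Aᵢⱼ − Aⱼᵢ)²/2 + tr(A)²/3`).
[ours; bookkeeping] -/
theorem norm_tfProj_le (A : Tens3) : ‖tfProj A‖ ≤ ‖A‖ := by
  have h2 : ‖tfProj A‖ ^ 2 ≤ ‖A‖ ^ 2 := by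
    rw [EuclideanSpace.norm_sq_eq, EuclideanSpace.norm_sq_eq, Fintype.sum_prod_type,
      Fintype.sum_prod_type]
    simp only [Real.norm_eq_abs, sq_abs, Fin.sum_univ_three, tfProj_apply, Fin.isValue,
      if_true, show (0 : Fin 3) ≠ 1 by decide, show (0 : Fin 3) ≠ 2 by decide,
      show (1 : Fin 3) ≠ 0 by decide, show (1 : Fin 3) ≠ 2 by decide,
      show (2 : Fin 3) ≠ 0 by decide, show (2 : Fin 3) ≠ 1 by decide, if_false, sub_zero]
    nlinarith [sq_nonneg (A (0, 1) - A (1, 0)), sq_nonneg (A (0, 2) - A (2, 0)),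
      sq_nonneg (A (1, 2) - A (2, 1)), sq_nonneg (A (0, 0) + A (1, 1) + A (2, 2))]
  exact (pow_le_pow_iff_left₀ (norm_nonneg _) (norm_nonneg _) two_ne_zero).1 h2

/-! ## 8. Convexity of `k_{q,c} ∘ π` on all flat tensors -/

/-- **`k_{q,c} ∘ π` is convex on `Tens3`** for `q ≥ 2` and `0 ≤ c ≤ c(q)` (§5 along lines + Lemma
(M′) + §6; the points where the line passes through `0` are handled by `k ≥ 0`, `k(0) = 0`).
[ours] -/
theorem convexOn_splitDensity_tfProj {q c : ℝ} (hq : 2 ≤ q) (hc0 : 0 ≤ c) (hc : c ≤ shareConst q) :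
    ConvexOn ℝ univ (fun A : Tens3 => splitDensity q c (tfProj A)) := by
  have hq0 : 0 < q := by linarith
  refine convexOn_univ_of_lines fun A Y => ?_
  have hB : IsSymTF (tfProj A) := isSymTF_tfProj A
  have hZ : IsSymTF (tfProj Y) := isSymTF_tfProj Y
  have hφ : (fun t : ℝ => splitDensity q c (tfProj (A + t • Y))) =
      fun t : ℝ => splitDensity q c (tfProj A + t • tfProj Y) := by
    funext t; rw [tfProj_add, tfProj_smul]
  show ConvexOn ℝ univ (fun t : ℝ => splitDensity q c (tfProj (A + t • Y)))
  rw [hφ]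
  refine convexOn_univ_of_local_midpoint
    ((continuous_splitDensity hq0 c).comp (by fun_prop)) fun m => ?_
  by_cases hP : tfProj A + m • tfProj Y = 0
  · refine ⟨1, one_pos, fun δ _ _ => ?_⟩
    have e0 : splitDensity q c (tfProj A + m • tfProj Y) = 0 := by rw [hP, splitDensity_zero hq0]
    have h1 := splitDensity_nonneg hq hc (hB.add (hZ.smul (m - δ)))
    have h2 := splitDensity_nonneg hq hc (hB.add (hZ.smul (m + δ)))
    show 2 * splitDensity q c (tfProj A + m • tfProj Y) ≤
      splitDensity q c (tfProj A + (m - δ) • tfProj Y) + splitDensity q c (tfProj A + (m + δ) • tfProj Y)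
    linarith
  · have hPn : 0 < ‖tfProj A + m • tfProj Y‖ := norm_pos_iff.mpr hP
    refine ⟨‖tfProj A + m • tfProj Y‖ / (2 * ‖tfProj Y‖ + 1), div_pos hPn (by positivity),
      fun δ hδ hδle => ?_⟩
    have hXB : 2 * ‖δ • tfProj Y‖ ≤ ‖tfProj A + m • tfProj Y‖ := by
      rw [norm_smul, Real.norm_of_nonneg hδ.le]
      have hZ0 := norm_nonneg (tfProj Y)
      have : δ * (2 * ‖tfProj Y‖ + 1) ≤ ‖tfProj A + m • tfProj Y‖ := by
        rwa [le_div_iff₀ (by positivity)] at hδle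
      nlinarith
    have key := splitDensity_secondDiff_nonneg hq hc0 hc (hB.add (hZ.smul m)) (hZ.smul δ) hP hXB
    have e1 : tfProj A + m • tfProj Y + δ • tfProj Y = tfProj A + (m + δ) • tfProj Y := by
      rw [add_smul, add_assoc]
    have e2 : tfProj A + m • tfProj Y - δ • tfProj Y = tfProj A + (m - δ) • tfProj Y := by
      rw [sub_smul, add_sub_assoc]
    rw [e1, e2] at key
    show 2 * splitDensity q c (tfProj A + m • tfProj Y) ≤
      splitDensity q c (tfProj A + (m - δ) • tfProj Y) + splitDensity q c (tfProj A + (m + δ) • tfProj Y)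
    linarith

/-! ## 9. The splitGauge `h = (k_{q,c}∘π / 2)^{1/q}`: convex, `1`-Lipschitz, and the splitting identity -/

/-- The GAUGE `h(A) = (k_{q,c}(πA)/2)^{1/q}`. [ours] -/
def splitGauge (q c : ℝ) (A : Tens3) : ℝ := (splitDensity q c (tfProj A) / 2) ^ q⁻¹

/-- `k_{q,c}(πA) ≥ 0` for `c ≤ c(q)`, `q ≥ 2`. [bookkeeping] -/
theorem splitDensity_tfProj_nonneg {q c : ℝ} (hq : 2 ≤ q) (hc : c ≤ shareConst q) (A : Tens3) :
    0 ≤ splitDensity q c (tfProj A) := splitDensity_nonneg hq hc (isSymTF_tfProj A)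

/-- `h ≥ 0` (`c ≤ c(q)`, `q ≥ 2`). [bookkeeping] -/
theorem splitGauge_nonneg {q c : ℝ} (hq : 2 ≤ q) (hc : c ≤ shareConst q) (A : Tens3) :
    0 ≤ splitGauge q c A :=
  Real.rpow_nonneg (div_nonneg (splitDensity_tfProj_nonneg hq hc A) two_pos.le) _

/-- `h(A)^q = k(πA)/2`. -/
theorem splitGauge_rpow {q c : ℝ} (hq : 2 ≤ q) (hc : c ≤ shareConst q) (A : Tens3) :
    splitGauge q c A ^ q = splitDensity q c (tfProj A) / 2 := by
  unfold splitGauge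
  exact Real.rpow_inv_rpow (div_nonneg (splitDensity_tfProj_nonneg hq hc A) two_pos.le)
    (by linarith : q ≠ 0)

/-- Positive homogeneity `h(tA) = t·h(A)`, `t ≥ 0`. -/
theorem splitGauge_smul {q c : ℝ} (hq : 2 ≤ q) (hc : c ≤ shareConst q) {t : ℝ} (ht : 0 ≤ t) (A : Tens3) :
    splitGauge q c (t • A) = t * splitGauge q c A := by
  unfold splitGauge
  rw [tfProj_smul, splitDensity_smul q c ht, mul_div_assoc,
    Real.mul_rpow (Real.rpow_nonneg ht q) (div_nonneg (splitDensity_tfProj_nonneg hq hc A) two_pos.le),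
    Real.rpow_rpow_inv ht (by linarith : q ≠ 0)]

/-- `h` is even. [bookkeeping] -/
theorem splitGauge_neg (q c : ℝ) (A : Tens3) : splitGauge q c (-A) = splitGauge q c A := by
  unfold splitGauge; rw [tfProj_neg, splitDensity_neg]

/-- `h ≤ ‖·‖` (`k ≤ f_q ≤ 2‖·‖^q` and `‖πA‖ ≤ ‖A‖`). -/
theorem splitGauge_le_norm {q c : ℝ} (hq : 2 ≤ q) (hc0 : 0 ≤ c) (hc : c ≤ shareConst q) (A : Tens3) :
    splitGauge q c A ≤ ‖A‖ := by
  have hq0 : 0 < q := by linarith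
  have h1 : splitDensity q c (tfProj A) / 2 ≤ ‖A‖ ^ q := by
    have hf := coreDensity_le_two_mul_normDensity hq0 (tfProj A)
    have hN : 0 ≤ normDensity q (tfProj A) := normDensity_nonneg q _
    have hπ : normDensity q (tfProj A) ≤ ‖A‖ ^ q := by
      rw [normDensity_eq]
      exact Real.rpow_le_rpow (norm_nonneg _) (norm_tfProj_le A) hq0.le
    unfold splitDensity
    nlinarith [mul_nonneg hc0 hN]
  calc splitGauge q c A ≤ (‖A‖ ^ q) ^ q⁻¹ :=
        Real.rpow_le_rpow (div_nonneg (splitDensity_tfProj_nonneg hq hc A) two_pos.le) h1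
          (inv_nonneg.2 hq0.le)
    _ = ‖A‖ := Real.rpow_rpow_inv (norm_nonneg A) hq0.ne'

/-- **The splitGauge is convex** (convexity and `q`-homogeneity of `k∘π`). [ours] -/
theorem convexOn_splitGauge {q c : ℝ} (hq : 2 ≤ q) (hc0 : 0 ≤ c) (hc : c ≤ shareConst q) :
    ConvexOn ℝ univ (splitGauge q c) := by
  have hq0 : 0 < q := by linarith
  have hK := convexOn_splitDensity_tfProj hq hc0 hc
  refine ⟨convex_univ, fun A _ B _ a b ha hb hab => ?_⟩
  simp only [smul_eq_mul]
  refine le_of_forall_pos_le_add fun ε hε => ?_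
  set u : ℝ := splitGauge q c A + ε with hudef
  set v : ℝ := splitGauge q c B + ε with hvdef
  have hu : 0 < u := by have := splitGauge_nonneg hq hc A; linarith
  have hv : 0 < v := by have := splitGauge_nonneg hq hc B; linarith
  -- the rescaled points have splitGauge ≤ 1, hence k∘π ≤ 2
  have hKle : ∀ {w : ℝ} (C : Tens3), 0 < w → splitGauge q c C ≤ w →
      splitDensity q c (tfProj (w⁻¹ • C)) ≤ 2 := by
    intro w C hw hCw
    have hg : splitGauge q c (w⁻¹ • C) ≤ 1 := by
      rw [splitGauge_smul hq hc (inv_nonneg.2 hw.le), inv_mul_le_iff₀ hw]; simpa using hCw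
    have := Real.rpow_le_one (splitGauge_nonneg hq hc _) hg hq0.le
    rw [splitGauge_rpow hq hc] at this
    linarith
  have hA2 := hKle A hu (by linarith)
  have hB2 := hKle B hv (by linarith)
  set w : ℝ := a * u + b * v with hwdef
  have hw0 : 0 ≤ w := by positivity
  -- the convex combination inside the unit splitGauge ball
  rcases hw0.eq_or_lt with hw | hw
  · -- then a·u = b·v = 0, so a = b = 0: impossible since a + b = 1
    exfalso
    have h1 : a * u = 0 := by nlinarith [mul_nonneg ha hu.le, mul_nonneg hb hv.le]
    have h2 : b * v = 0 := by nlinarith [mul_nonneg ha hu.le, mul_nonneg hb hv.le]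
    rcases mul_eq_zero.1 h1 with h | h
    · rcases mul_eq_zero.1 h2 with h' | h'
      · linarith
      · linarith
    · linarith
  · have hsum : a * u / w + b * v / w = 1 := by
      rw [← add_div, div_self hw.ne']
    have hcomb := hK.2 (mem_univ (u⁻¹ • A)) (mem_univ (v⁻¹ • B))
      (div_nonneg (mul_nonneg ha hu.le) hw.le) (div_nonneg (mul_nonneg hb hv.le) hw.le) hsum
    simp only [smul_eq_mul] at hcomb
    have hin : splitDensity q c (tfProj ((a * u / w) • (u⁻¹ • A) + (b * v / w) • (v⁻¹ • B))) ≤ 2 := by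
      have : a * u / w * splitDensity q c (tfProj (u⁻¹ • A)) +
          b * v / w * splitDensity q c (tfProj (v⁻¹ • B)) ≤ a * u / w * 2 + b * v / w * 2 :=
        add_le_add (mul_le_mul_of_nonneg_left hA2 (div_nonneg (mul_nonneg ha hu.le) hw.le))
          (mul_le_mul_of_nonneg_left hB2 (div_nonneg (mul_nonneg hb hv.le) hw.le))
      have e2 : a * u / w * 2 + b * v / w * 2 = 2 := by rw [← add_mul, hsum, one_mul]
      linarith
    have e : a • A + b • B = w • ((a * u / w) • (u⁻¹ • A) + (b * v / w) • (v⁻¹ • B)) := by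
      rw [smul_add, smul_smul, smul_smul, smul_smul, smul_smul]
      congr 1 <;> congr 1
      · field_simp
      · field_simp
    have hg1 : splitGauge q c ((a * u / w) • (u⁻¹ • A) + (b * v / w) • (v⁻¹ • B)) ≤ 1 := by
      unfold splitGauge
      exact Real.rpow_le_one (div_nonneg (splitDensity_tfProj_nonneg hq hc _) two_pos.le)
        (by linarith) (inv_nonneg.2 hq0.le)
    calc splitGauge q c (a • A + b • B)
        = w * splitGauge q c ((a * u / w) • (u⁻¹ • A) + (b * v / w) • (v⁻¹ • B)) := by
          rw [e, splitGauge_smul hq hc hw.le]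
      _ ≤ w * 1 := mul_le_mul_of_nonneg_left hg1 hw.le
      _ = a * splitGauge q c A + b * splitGauge q c B + ε := by
          rw [mul_one, hwdef, hudef, hvdef]; linear_combination ε * hab

/-- Subadditivity of the splitGauge. -/
theorem splitGauge_add_le {q c : ℝ} (hq : 2 ≤ q) (hc0 : 0 ≤ c) (hc : c ≤ shareConst q) (A B : Tens3) :
    splitGauge q c (A + B) ≤ splitGauge q c A + splitGauge q c B := by
  have h := (convexOn_splitGauge hq hc0 hc).2 (mem_univ A) (mem_univ B)
    (by norm_num : (0 : ℝ) ≤ 1 / 2) (by norm_num : (0 : ℝ) ≤ 1 / 2) (by norm_num)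
  have e : (1 / 2 : ℝ) • A + (1 / 2 : ℝ) • B = (1 / 2 : ℝ) • (A + B) := by rw [smul_add]
  rw [e, splitGauge_smul hq hc (by norm_num)] at h
  simp only [smul_eq_mul] at h
  linarith

/-- **The splitGauge is `1`-Lipschitz.** [ours] -/
theorem lipschitzWith_splitGauge {q c : ℝ} (hq : 2 ≤ q) (hc0 : 0 ≤ c) (hc : c ≤ shareConst q) :
    LipschitzWith 1 (splitGauge q c) :=
  LipschitzWith.of_le_add fun A B => by
    have h1 := splitGauge_add_le hq hc0 hc B (A - B)
    rw [add_sub_cancel] at h1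
    have h2 := splitGauge_le_norm hq hc0 hc (A - B)
    rw [dist_eq_norm]; linarith

/-- **The splitting identity** on symmetric trace-free tensors:
`λ(A)^q + λ(−A)^q = 2·h(A)^q + c·‖A‖^q`. [ours] -/
theorem splitting_identity {q c : ℝ} (hq : 2 ≤ q) (hc : c ≤ shareConst q) {A : Tens3}
    (hA : IsSymTF A) : lam A ^ q + lam (-A) ^ q = 2 * splitGauge q c A ^ q + c * ‖A‖ ^ q := by
  rw [splitGauge_rpow hq hc, tfProj_of_isSymTF hA, splitDensity, coreDensity_eq hA, normDensity_eq]
  ring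

/-- **K10 — the splitting of the symmetrised top–bottom core, every real `q ≥ 2`, with the share
`c(q) = shareConst q > 0`**: the statement `TopBotEigSplitting q (shareConst q)` of the K9 file,
written out. [ours] -/
theorem topBotEigSplitting_shareConst {q : ℝ} (hq : 2 ≤ q) :
    ∃ M : ℝ, 0 ≤ M ∧ ∃ h : EuclideanSpace ℝ (Fin 3 × Fin 3) → ℝ,
      ConvexOn ℝ univ h ∧ LipschitzWith 1 h ∧
        ∀ A : EuclideanSpace ℝ (Fin 3 × Fin 3), (∀ i j, A (i, j) = A (j, i)) →
          ∑ i, A (i, i) = 0 →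
            0 ≤ h A ∧ lam A ^ q + lam (-A) ^ q = M * h A ^ q + shareConst q * ‖A‖ ^ q :=
  ⟨2, two_pos.le, splitGauge q (shareConst q), convexOn_splitGauge hq (shareConst_pos hq).le le_rfl,
    lipschitzWith_splitGauge hq (shareConst_pos hq).le le_rfl, fun A hs ht =>
      ⟨splitGauge_nonneg hq le_rfl A, splitting_identity hq le_rfl ⟨hs, ht⟩⟩⟩

/-- **K10, existential form**: `∃ c > 0, TopBotEigSplitting q c` written out, every real
`q ≥ 2`. Composed with K9 (`topBotEigHeatCoercivePos_of_splitting`) it gives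
`TopBotEigHeatCoercivePos q` for every real `q > 2` (JOINT check file). [ours] -/
theorem topBotEigSplitting_exists {q : ℝ} (hq : 2 ≤ q) :
    ∃ c : ℝ, 0 < c ∧ ∃ M : ℝ, 0 ≤ M ∧ ∃ h : EuclideanSpace ℝ (Fin 3 × Fin 3) → ℝ,
      ConvexOn ℝ univ h ∧ LipschitzWith 1 h ∧
        ∀ A : EuclideanSpace ℝ (Fin 3 × Fin 3), (∀ i j, A (i, j) = A (j, i)) →
          ∑ i, A (i, i) = 0 →
            0 ≤ h A ∧ lam A ^ q + lam (-A) ^ q = M * h A ^ q + c * ‖A‖ ^ q :=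
  ⟨shareConst q, shareConst_pos hq, topBotEigSplitting_shareConst hq⟩

end TopEig

end Summit.NavierStokesRegularity.FunctionalMining
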